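import Literature.RingTheory.CohomologyAnnihilator.Basic
import Literature.AlgebraicGeometry.Resolution.LocalBlowup
import Literature.AlgebraicGeometry.Resolution.LocalUniformization
import Mathlib.RingTheory.Adjoin.FG
import HarnessLib

/-!
# Route HomologicalConductor — crux `Globalisation` (stmt-ResolutionOfSingularities-16486): `stub_lurel`

Line `birth_HomologicalConductor` (v2, "lu-patching cut"), stub `stub_lurel`: valuative
termination of the canonical ca-tower `T₀ = loc A`, `T_(m+1) = loc (nrm (chart T_m))` along
every valuation ring `O ⊇ k` of `K`, together with the fact that every tower stage is the local
ring at the centre of `O` of a finitely generated model (`(tower A m).toSubring =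
locAtCentre A_m O`, `A ≤ A_m ⊆ O`), IS relative local uniformization in characteristic `p`
(`LUrel_p`, the shape consumed by the tree's Zariski patching theorems): enlarge `R` to an
affine model `A = R ⊔ A₀` (`exists_affineModel`), run the tower, and read regularity of the
terminal stage `T_m = locAtCentre A_m O` on `Localization.AtPrime` of the centre
(`isRegularLocalRing_locAtCentre_iff`).
-/

-- single-problem summit: the doubled namespace component `ResolutionOfSingularities` is forced
set_option linter.dupNamespace false

namespace Summit.ResolutionOfSingularities.ResolutionOfSingularities.Theorems.HomologicalConductorGlobalisation

open Literature.AlgebraicGeometry.Resolution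

section Helpers

variable {k K : Type} [Field k] [Field K] [Algebra k K]

/-- A subalgebra containing an affine model of `K` is again a model of `K`. [folklore] -/
theorem lurel_isFractionRing_of_le {A A' : Subalgebra k K} (hle : A ≤ A')
    (hA : IsFractionRing ↥A K) : IsFractionRing ↥A' K := by
  refine IsFractionRing.of_field ↥A' K fun z => ?_
  obtain ⟨a, b, -, rfl⟩ := IsFractionRing.div_surjective (A := ↥A) z
  exact ⟨⟨a, hle a.2⟩, ⟨b, hle b.2⟩, rfl⟩

/-- A `k`-subalgebra whose underlying subring lies in `O` lies in `O` viewed as a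
`k`-subalgebra. [folklore] -/
theorem lurel_sup_toSubring_le {O : ValuationSubring K} (hO : ∀ c : k, algebraMap k K c ∈ O)
    {R A : Subalgebra k K} (hR : R.toSubring ≤ O.toSubring) (hA : A.toSubring ≤ O.toSubring) :
    (R ⊔ A).toSubring ≤ O.toSubring := by
  let Oalg : Subalgebra k K := { O.toSubring with algebraMap_mem' := hO }
  have hle : R ⊔ A ≤ Oalg := sup_le (fun x hx => hR hx) (fun x hx => hA hx)
  exact fun x hx => hle hx

/-- Transport of regularity along an equality of a subalgebra's subring with a subring.
[folklore] -/
theorem lurel_isRegularLocalRing_of_toSubring_eq {T : Subalgebra k K} {S : Subring K}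
    (h : T.toSubring = S) (hT : IsRegularLocalRing ↥T) : IsRegularLocalRing ↥S := by
  subst h
  exact hT

end Helpers

/-- **Valuative termination of the canonical tower of models is relative local uniformization**
(`LUrel_p`): given that every tower stage is `locAtCentre A_m O` for a finitely generated
`A ≤ A_m ⊆ O` (`h₄`) and that the tower terminates along every valuation ring (`hVT`), every
finitely generated `R ⊆ O` is dominated by a finitely generated model `A ⊆ O` of `K` that is
regular at the centre of `O`. [cite: Piltant2013, Axiom 5] -/
theorem stub_lurel (h₄ : ∀ {k K : Type} [Field k] [Field K] [Algebra k K] (O : ValuationSubring K) (A : Subalgebra k K), A.FG → IsFractionRing ↥A K → A.toSubring ≤ O.toSubring → ∀ m : ℕ, let ca : Subalgebra k K → Set K := fun A => {x : K | ∃ hx : x ∈ A, ∃ n : ℕ, ∀ i : ℕ, n ≤ i → ∀ (M N : ModuleCat.{0} ↥A), Module.Finite ↥A M → Module.Finite ↥A N → ∀ e : CategoryTheory.Abelian.Ext.{0} M N i, (⟨x, hx⟩ : ↥A) • e = 0}; let loc : Subalgebra k K → Subalgebra k K := fun A => Algebra.adjoin k {y : K | ∃ a ∈ A, ∃ s ∈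 A, s⁻¹ ∈ O ∧ y = a * s⁻¹}; let chart : Subalgebra k K → Subalgebra k K := fun A => Algebra.adjoin k ((A : Set K) ∪ {y : K | ∃ c ∈ ca A, ∃ x ∈ ca A, x ≠ 0 ∧ (∀ c' ∈ ca A, c' * x⁻¹ ∈ O) ∧ y = c * x⁻¹}); let nrm : Subalgebra k K → Subalgebra k K := fun B => Algebra.adjoin k {y : K | IsIntegral ↥B y}; let tower : Subalgebra k K → ℕ → Subalgebra k K := fun A m => @Nat.rec (fun _ => Subalgebra k K) (loc A) (fun _ B => loc (nrm (chart B))) m; ∃ Am : Subalgebra k K, Am.FG ∧ A ≤ Am ∧ Am.toSubring ≤ O.toSubring ∧ (tower A m).toSubring = Literature.AlgebraicGeometry.Resolution.locAtCentre Am.toSubring O) (p : ℕ) (hVT : ∀ (k K : Type) [Field k] [CharP k p] [Field K] [Algebra k K] (O : ValuationSubring K) (A : Subalgebra k K), (∀ c : k, algebraMap k K c ∈ O) → A.FG → IsFractionRing ↥A K → A.toSubring ≤ O.toSubring → let ca : Subalgebra k K → Set K := fun A => {x : K | ∃ hx : x ∈ A, ∃ n : ℕ, ∀ i : ℕ, n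 ≤ i → ∀ (M N : ModuleCat.{0} ↥A), Module.Finite ↥A M → Module.Finite ↥A N → ∀ e : CategoryTheory.Abelian.Ext.{0} M N i, (⟨x, hx⟩ : ↥A) • e = 0}; let loc : Subalgebra k K → Subalgebra k K := fun A => Algebra.adjoin k {y : K | ∃ a ∈ A, ∃ s ∈ A, s⁻¹ ∈ O ∧ y = a * s⁻¹}; let chart : Subalgebra k K → Subalgebra k K := fun A => Algebra.adjoin k ((A : Set K) ∪ {y : K | ∃ c ∈ ca A, ∃ x ∈ ca A, x ≠ 0 ∧ (∀ c' ∈ ca A, c' * x⁻¹ ∈ O) ∧ y = c * x⁻¹}); let nrm : Subalgebra k K → Subalgebra k K := fun B => Algebra.adjoin k {y : K | IsIntegral ↥B y}; let tower : Subalgebra k K → ℕ → Subalgebra k K := fun A m => @Nat.rec (fun _ => Subalgebra k K) (loc A) (fun _ B => loc (nrm (chart B))) m; ∃ m : ℕ, IsRegularLocalRing ↥(tower A m)) :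
    ∀ (k K : Type) [Field k] [CharP k p] [Field K] [Algebra k K], (⊤ : IntermediateField k K).FG → ∀ O : ValuationSubring K, (∀ c : k, algebraMap k K c ∈ O) → ∀ R : Subalgebra k K, R.FG → R.toSubring ≤ O.toSubring → ∃ (A : Subalgebra k K) (h : A.toSubring ≤ O.toSubring), R ≤ A ∧ A.FG ∧ IsFractionRing ↥A K ∧ IsRegularLocalRing (Localization.AtPrime (Ideal.comap (Subring.inclusion h) (IsLocalRing.maximalIdeal ↥O))) := by
  intro k K _ _ _ _ hKfg O hO R hRfg hRO
  -- an affine model `A₀ ⊆ O` of `K`; the model `R ⊔ A₀ ⊆ O` contains `R`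
  rcases exists_affineModel k K hKfg O hO with ⟨A₀, hA₀O, hA₀fg, hA₀fr⟩
  -- run the tower on `R ⊔ A₀`: it terminates at some stage `m` (`hVT`) ...
  rcases hVT k K O (R ⊔ A₀) hO (hRfg.sup hA₀fg) (lurel_isFractionRing_of_le le_sup_right hA₀fr)
    (lurel_sup_toSubring_le hO hRO hA₀O) with ⟨m, hm⟩
  -- ... and stage `m` is `locAtCentre Am O` for a finitely generated model `R ⊔ A₀ ≤ Am ⊆ O` (`h₄`)
  rcases h₄ O (R ⊔ A₀) (hRfg.sup hA₀fg) (lurel_isFractionRing_of_le le_sup_right hA₀fr)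
    (lurel_sup_toSubring_le hO hRO hA₀O) m with ⟨Am, hAmfg, hAAm, hAmO, heq⟩
  -- transport regularity to `locAtCentre Am O`, then to `Localization.AtPrime` of the centre
  exact ⟨Am, hAmO, le_sup_left.trans hAAm, hAmfg,
    lurel_isFractionRing_of_le (le_sup_right.trans hAAm) hA₀fr,
    (isRegularLocalRing_locAtCentre_iff hAmO).mp (lurel_isRegularLocalRing_of_toSubring_eq heq hm)⟩

end Summit.ResolutionOfSingularities.ResolutionOfSingularities.Theorems.HomologicalConductorGlobalisation
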